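import Literature.NumberTheory.EllipticCurves.Kato2004.Condition1252
import Literature.NumberTheory.EllipticCurves.KatzLatticeRationalTorsionProofs
import Literature.NumberTheory.EllipticCurves.Rank1Residual.Predicates
import HarnessLib

/-!
# (im) at EVERY finite level: an (im)-witness `σ` has `E[p^m]/(σ − 1)E[p^m] ≅ ℤ/p^m` — Mazur–Rubin's
# hypothesis (H.2) for `T = E[p^m]`, `R = ℤ/p^m`, as used by Sakamoto (JTNB 36 (2024) §2) at `p = 3`
# (cell `b2b-bsdres`, team n1011, sub-target T-a3-F1 Stage 1 / T-a3 ledger row S1 (H.2); seat p13)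

HONEST FRAMING (cell `b2b-bsdres`, run/shared/lean/b2b/bsd-rank1-residual/, verbatim in every
file): the goal of the cell is to DELETE the COMBINATION-SHAPED residual classes of the
Birch–Swinnerton-Dyer formula for ALL analytic-rank `≤ 1` elliptic curves over `ℚ` — "full BSD
formula for every rank `≤ 1` curve in class `C`" assembled STRICTLY from published theorems — so
that the rank-`≤ 1` remainder becomes exactly the CONSTRUCTION-SHAPED classes, which are TYPED
(missing-input `Prop`s), NOT attempted. This is not "finishing BSD". Team n1011: prove what is
provable now; no claim beyond stated classes. Theorems only (no definition, no named fact); nothing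
is booked; no label changes.

## What and why

Sakamoto, *The theory of Kolyvagin systems for `p = 3`*, JTNB 36 (2024) 919–946, §2 (p. 921), works
with a free module `T` over a zero-dimensional Gorenstein local ring `R` with `3^α R = 0` and assumes

> (H.2) There is an element `τ ∈ G_{H_α}` such that `T/(τ − 1)T ≅ R` as `R`-modules

(`H_α = K(μ_{3^α})`), verbatim Mazur–Rubin, Mem. AMS 799 (2004) §3.5 (H.2). For the N11 chain at
`p = 3` (T-a3 / T-a4: Kim 2025's `p = 3` case rests on Sakamoto's Thm. 4.4) the instance is
`K = ℚ`, `R = ℤ/3^m`, `T = E[3^m]`. The tree's (im) is the `ℤ_p`-ADIC statement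
`Rank1Residual.BigIm W p` ("`∃ σ ∈ G_{ℚ(μ_{p^∞})}` with `T_pE/(σ − 1)T_pE ≅ ℤ_p`", BCS 2025 (im) =
Kato 2004 Thm. 13.4 (3)). This file proves that the adic witness serves at EVERY finite level:

* `torsion_quotient_equiv_zmod_of_bigImWitness` — for `σ` with `T_pE/(σ−1)T_pE ≃ₗ[ℤ_p] ℤ_p` and every
  `m`, the cokernel of `σ − 1` on `E[p^m]` is (additively) isomorphic to `ℤ/p^m` (it is cyclic,
  generated by the image of a lift of a generator of `T_pE/(σ−1)T_pE`, of order exactly `p^m`: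
  reduction of `T_pE → E[p^m]`, kernel `p^m T_pE`);
* `exists_torsion_quotient_equiv_zmod_of_bigIm` — **(im) ⟹ (H.2) for `(E[p^m], ℤ/p^m)` for every
  `m`, with the SAME `σ`, which fixes every `p`-power root of unity** (so `σ ∈ G_{ℚ(μ_{p^α})}` for
  every `α`, as (H.2) wants);
* `exists_torsion_quotient_equiv_zmod_of_towerSurj` — from `3`-adic (tower) surjectivity, via the
  tree's `Kato2004.exists_quotient_range_sub_one_equiv_of_imageContainsSL2`; this is T-a3's ledger
  row "S1 (H.2) ⟸ (T)" (skel/T-a3.md v2) as a kernel theorem (for `K = ℚ`; the `Ind`-version over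
  an abelian `3`-extension is Shapiro bookkeeping, not done here).

An `R`-module isomorphism with `R = ℤ/p^m` is the same as an isomorphism of abelian groups (the
`R`-structure of a `p^m`-torsion group is unique), so the additive form below IS (H.2).

References: R. Sakamoto, JTNB 36 (2024) 919–946, §2 (H.1)–(H.3), (H.SD) (p. 921) [Sakamoto2024];
B. Mazur, K. Rubin, Mem. AMS 799 (2004) §3.5; Burungale–Castella–Skinner 2025 (im)
[BurungaleCastellaSkinner2025]; K. Kato, Astérisque 295 (2004) Thm. 13.4 (3) [Kato2004Asterisque].
-/

noncomputable section

open scoped Classical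

open WeierstrassCurve Field Literature.NumberTheory.EllipticCurves
  Literature.NumberTheory.EllipticCurves.Rank1Residual

namespace Summit.BirchSwinnertonDyer.Rank1Residual.GaloisImage

variable (W : WeierstrassCurve ℚ) [W.IsElliptic] (p : ℕ) [hp : Fact p.Prime]

/-- **The cokernel of an (im)-witness on `E[p^m]` is `ℤ/p^m`.** If `T_pE/(ρ(σ) − 1)T_pE ≅ ℤ_p`
(`ℤ_p`-linearly), then for every `m` the quotient of `E[p^m]` by the image of `σ − 1` is additively
isomorphic to `ZMod (p^m)`: it is cyclic, generated by the reduction of a lift `t₀` of a generator of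
`T_pE/(σ − 1)T_pE`, and `n • t̄₀ = 0` forces `p^m ∣ n` (reduce the `ℤ_p`-coordinate modulo `p^m`;
`ker(T_pE → E[p^m]) = p^m T_pE`). Mazur–Rubin (H.2) for `(E[p^m], ℤ/p^m)` from the adic (im).
[cite: Sakamoto2024, §2 hypothesis (H.2) (p. 921)] [cite: BurungaleCastellaSkinner2025, hypothesis (im)] -/
theorem torsion_quotient_equiv_zmod_of_bigImWitness (σ : absoluteGaloisGroup ℚ)
    (Ψ : ((W.tateModule p) ⧸ LinearMap.range (W.galoisRepTate p σ - LinearMap.id)) ≃ₗ[ℤ_[p]] ℤ_[p])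
    (m : ℕ) :
    Nonempty ((geomTorsion W ((p ^ m : ℕ) : ℤ) ⧸
      ((Multiplicative.toAdd (galoisRepTorsion W ((p ^ m : ℕ) : ℤ) σ)).toAddMonoidHom -
        AddMonoidHom.id (geomTorsion W ((p ^ m : ℕ) : ℤ))).range) ≃+ ZMod (p ^ m)) := by
  have hpP : p.Prime := hp.out
  set S : Submodule ℤ_[p] (W.tateModule p) := LinearMap.range (W.galoisRepTate p σ - LinearMap.id)
    with hS
  set E := geomTorsion W ((p ^ m : ℕ) : ℤ) with hE
  set f : E →+ E :=
    (Multiplicative.toAdd (galoisRepTorsion W ((p ^ m : ℕ) : ℤ) σ)).toAddMonoidHom - AddMonoidHom.id E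
    with hf
  set R : AddSubgroup E := f.range with hR
  -- the reduction `π : T_pE → E[p^m]`
  set π : W.tateModule p →+ E :=
    (TateModule.proj p m).codRestrict E (proj_tateModule_mem_geomTorsion W p m) with hπ
  have hπsurj : Function.Surjective π := by
    intro P
    obtain ⟨a, ha⟩ := proj_surjective_of_isAlgClosed_holds W p m P.2
    exact ⟨a, Subtype.ext ha⟩
  have hπker : ∀ a, π a = 0 → ∃ b : W.tateModule p, a = (p : ℤ_[p]) ^ m • b := by
    intro a ha
    have h0 : TateModule.proj p m a = 0 := congrArg Subtype.val ha
    exact TateModule.exists_eq_pow_smul_of_proj_eq_zero m a h0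
  have hπsmul : ∀ a, π (σ • a) = σ • π a := fun a => Subtype.ext rfl
  -- `E[p^m]` is `p^m`-torsion
  have hpE : ∀ e : E, p ^ m • e = 0 := by
    intro e
    apply Subtype.ext
    have he : (((p ^ m : ℕ) : ℤ) • (e : geomPoints W)) = 0 :=
      (Submodule.mem_torsionBy_iff _ _).mp e.2
    rw [AddSubmonoidClass.coe_nsmul, ZeroMemClass.coe_zero, ← natCast_zsmul, he]
  -- `ψ = mk ∘ π`
  set ψ : W.tateModule p →+ E ⧸ R := (QuotientAddGroup.mk' R).comp π with hψ
  have hψ_apply : ∀ a, ψ a = QuotientAddGroup.mk (π a) := fun a => rfl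
  have hfπ : ∀ b : W.tateModule p, f (π b) = π (σ • b - b) := by
    intro b
    rw [map_sub, hπsmul, hf, AddMonoidHom.sub_apply, AddMonoidHom.id_apply,
      AddEquiv.coe_toAddMonoidHom]
    rfl
  have hsub_mem : ∀ b : W.tateModule p, σ • b - b ∈ S := fun b =>
    ⟨b, by rw [LinearMap.sub_apply, galoisRepTate_apply_apply, LinearMap.id_apply]⟩
  -- Claim A: `ψ` kills `S`
  have hA : ∀ a ∈ S, ψ a = 0 := by
    rintro a ⟨b, rfl⟩
    rw [hψ_apply, QuotientAddGroup.eq_zero_iff, LinearMap.sub_apply, galoisRepTate_apply_apply,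
      LinearMap.id_apply, ← hfπ]
    exact ⟨π b, rfl⟩
  -- Claim B: `ψ` kills `p^m T`
  have hB : ∀ a : W.tateModule p, ψ ((p : ℤ_[p]) ^ m • a) = 0 := by
    intro a
    rw [← Nat.cast_pow, Nat.cast_smul_eq_nsmul, hψ_apply, map_nsmul, hpE, QuotientAddGroup.mk_zero]
  -- Claim C: exactness
  have hC : ∀ a : W.tateModule p, ψ a = 0 →
      ∃ s ∈ S, ∃ b : W.tateModule p, a = s + (p : ℤ_[p]) ^ m • b := by
    intro a ha
    rw [hψ_apply, QuotientAddGroup.eq_zero_iff] at ha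
    obtain ⟨e, he⟩ := ha
    obtain ⟨b, rfl⟩ := hπsurj e
    rw [hfπ] at he
    have hker : π (a - (σ • b - b)) = 0 := by rw [map_sub, he, sub_self]
    obtain ⟨c, hc⟩ := hπker _ hker
    exact ⟨σ • b - b, hsub_mem b, c, by rw [← hc]; abel⟩
  -- a lift `t₀` of a generator of `T/S`
  obtain ⟨t₀, ht₀⟩ := Submodule.Quotient.mk_surjective S (Ψ.symm 1)
  have hQ1 : ∀ a : W.tateModule p, ∃ c : ℤ_[p], a - c • t₀ ∈ S := by
    intro a
    refine ⟨Ψ (Submodule.Quotient.mk a), (Submodule.Quotient.eq S).mp ?_⟩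
    rw [Submodule.Quotient.mk_smul, ht₀]
    apply Ψ.injective
    rw [map_smul, LinearEquiv.apply_symm_apply, smul_eq_mul, mul_one]
  have hQ2 : ∀ n : ℕ, (∃ s ∈ S, ∃ b : W.tateModule p,
      ((n : ℤ_[p]) • t₀ : W.tateModule p) = s + (p : ℤ_[p]) ^ m • b) → p ^ m ∣ n := by
    rintro n ⟨s, hs, b, hb⟩
    have h1 : (n : ℤ_[p]) • Submodule.Quotient.mk (p := S) t₀ =
        ((p : ℤ_[p]) ^ m) • Submodule.Quotient.mk (p := S) b := by
      rw [← Submodule.Quotient.mk_smul, hb, Submodule.Quotient.mk_add,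
        (Submodule.Quotient.mk_eq_zero S).mpr hs, zero_add, Submodule.Quotient.mk_smul]
    have h2 := congrArg Ψ h1
    rw [map_smul, map_smul, ht₀, LinearEquiv.apply_symm_apply, smul_eq_mul, mul_one,
      smul_eq_mul] at h2
    have h3 := congrArg (PadicInt.toZModPow (p := p) m) h2
    rw [map_natCast, map_mul, map_pow, map_natCast, ← Nat.cast_pow, ZMod.natCast_self,
      zero_mul] at h3
    exact (ZMod.natCast_eq_zero_iff n (p ^ m)).mp h3
  -- decomposition `c = n + p^m c'`
  have hdecomp : ∀ c : ℤ_[p], ∃ (n : ℕ) (c' : ℤ_[p]), c = n + (p : ℤ_[p]) ^ m * c' := by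
    intro c
    refine ⟨(PadicInt.toZModPow m c).val, ?_⟩
    have hk : c - ((PadicInt.toZModPow m c).val : ℤ_[p]) ∈
        RingHom.ker (PadicInt.toZModPow (p := p) m) := by
      rw [RingHom.mem_ker, map_sub, map_natCast, ZMod.natCast_zmod_val, sub_self]
    rw [PadicInt.ker_toZModPow, Ideal.mem_span_singleton] at hk
    obtain ⟨c', hc'⟩ := hk
    exact ⟨c', by rw [← hc']; abel⟩
  -- the generator `x₀ = ψ t₀` of `E[p^m]/R`
  set x₀ : E ⧸ R := ψ t₀ with hx₀
  have hψsmul : ∀ c : ℤ_[p], ∃ n : ℕ, ψ (c • t₀) = n • x₀ := by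
    intro c
    obtain ⟨n, c', rfl⟩ := hdecomp c
    refine ⟨n, ?_⟩
    rw [add_smul, map_add, mul_smul, hB, add_zero, Nat.cast_smul_eq_nsmul, map_nsmul]
  have hgen : ∀ y : E ⧸ R, ∃ n : ℕ, y = n • x₀ := by
    intro y
    obtain ⟨e, rfl⟩ := QuotientAddGroup.mk_surjective y
    obtain ⟨a, rfl⟩ := hπsurj e
    obtain ⟨c, hc⟩ := hQ1 a
    obtain ⟨n, hn⟩ := hψsmul c
    refine ⟨n, ?_⟩
    rw [← hn, ← hψ_apply, ← sub_eq_zero, ← map_sub]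
    exact hA _ hc
  have horder : ∀ n : ℕ, n • x₀ = 0 → p ^ m ∣ n := by
    intro n hn
    apply hQ2 n
    apply hC
    rw [Nat.cast_smul_eq_nsmul, map_nsmul]
    exact hn
  have hpx₀ : p ^ m • x₀ = 0 := by
    rw [hx₀, ← map_nsmul, ← Nat.cast_smul_eq_nsmul ℤ_[p], Nat.cast_pow, hB]
  have hord : addOrderOf x₀ = p ^ m := by
    apply Nat.dvd_antisymm (addOrderOf_dvd_of_nsmul_eq_zero hpx₀)
    exact horder _ (addOrderOf_nsmul_eq_zero x₀)
  have htop : AddSubgroup.zmultiples x₀ = ⊤ := by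
    rw [eq_top_iff]
    intro y _
    obtain ⟨n, rfl⟩ := hgen y
    exact (AddSubgroup.zmultiples x₀).nsmul_mem (AddSubgroup.mem_zmultiples x₀) n
  have hcyc : IsAddCyclic (E ⧸ R) := isAddCyclic_iff_exists_zmultiples_eq_top.mpr ⟨x₀, htop⟩
  have hcard : Nat.card (E ⧸ R) = p ^ m := by
    rw [← AddSubgroup.card_top, ← htop, Nat.card_zmultiples, hord]
  exact ⟨((zmodAddCyclicAddEquiv hcyc).symm).trans (ZMod.ringEquivCongr hcard).toAddEquiv⟩

/-- **(im) ⟹ (H.2) for `(E[p^m], ℤ/p^m)`, every `m`, one `σ` for all levels.** From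
`Rank1Residual.BigIm W p` (BCS (im) / Kato 13.4 (3): `σ ∈ G_{ℚ(μ_{p^∞})}` with
`T_pE/(σ−1)T_pE ≅ ℤ_p`): the same `σ` fixes every `p`-power root of unity (so lies in `G_{ℚ(μ_{p^α})}`
for every `α`) and has `E[p^m]/(σ − 1)E[p^m] ≃+ ℤ/p^m` for every `m` — Sakamoto 2024 §2 / Mazur–Rubin
(H.2) for the level-`m` Kolyvagin-system setting of the N11 chain at `p = 3`.
[cite: Sakamoto2024, §2 hypothesis (H.2) (p. 921)] [cite: BurungaleCastellaSkinner2025, hypothesis (im)] -/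
theorem exists_torsion_quotient_equiv_zmod_of_bigIm (him : BigIm W p) :
    ∃ σ : absoluteGaloisGroup ℚ,
      (∀ (n : ℕ) (t : AlgebraicClosure ℚ), t ^ p ^ n = 1 → σ • t = t) ∧
      ∀ m : ℕ, Nonempty ((geomTorsion W ((p ^ m : ℕ) : ℤ) ⧸
        ((Multiplicative.toAdd (galoisRepTorsion W ((p ^ m : ℕ) : ℤ) σ)).toAddMonoidHom -
          AddMonoidHom.id (geomTorsion W ((p ^ m : ℕ) : ℤ))).range) ≃+ ZMod (p ^ m)) := by
  obtain ⟨σ, hσζ, ⟨Ψ⟩⟩ := him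
  refine ⟨σ, fun n t ht => ?_, fun m => torsion_quotient_equiv_zmod_of_bigImWitness W p σ Ψ m⟩
  rw [absoluteGaloisGroup.smul_def]
  exact hσζ t n ht

/-- **(T) ⟹ (H.2) at every level**: from `p`-adic (tower) surjectivity `∀ n, ρ̄_{E,p^n}` onto — T-a3's
binder (T), `= Kato2004.ImageContainsSL2 W p` — there is `σ ∈ G_{ℚ(μ_{p^∞})}` with
`E[p^m]/(σ − 1)E[p^m] ≃+ ℤ/p^m` for every `m` (ledger row S1 (H.2) of skel/T-a3.md, `K = ℚ`).
[cite: Sakamoto2024, §2 hypothesis (H.2) (p. 921)] [cite: Kato2004Asterisque, Thm. 13.4 (3) (p. 226)] -/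
theorem exists_torsion_quotient_equiv_zmod_of_towerSurj
    (htower : ∀ n : ℕ, W.HasSurjectiveModNGaloisRep (p ^ n : ℕ)) :
    ∃ σ : absoluteGaloisGroup ℚ,
      (∀ (n : ℕ) (t : AlgebraicClosure ℚ), t ^ p ^ n = 1 → σ • t = t) ∧
      ∀ m : ℕ, Nonempty ((geomTorsion W ((p ^ m : ℕ) : ℤ) ⧸
        ((Multiplicative.toAdd (galoisRepTorsion W ((p ^ m : ℕ) : ℤ) σ)).toAddMonoidHom -
          AddMonoidHom.id (geomTorsion W ((p ^ m : ℕ) : ℤ))).range) ≃+ ZMod (p ^ m)) := by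
  obtain ⟨σ, hσ, ⟨Ψ⟩⟩ := Kato2004.exists_quotient_range_sub_one_equiv_of_imageContainsSL2 W p
    (Kato2004.imageContainsSL2_of_forall_hasSurjectiveModNGaloisRep W p htower)
  refine ⟨σ, hσ, fun m => torsion_quotient_equiv_zmod_of_bigImWitness W p σ ?_ m⟩
  simpa only [Module.End.one_eq_id] using Ψ

end Summit.BirchSwinnertonDyer.Rank1Residual.GaloisImage

end
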